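import Mathlib.Topology.Instances.AddCircle.Real
import Mathlib.Analysis.Normed.Group.AddCircle
import Mathlib.Algebra.Group.Pointwise.Finset.Basic
import Mathlib.Data.Real.Basic
import Mathlib.Tactic
import HarnessLib

/-!
# Route `GreenTaoLevelTwo`, crux `GITwo` (stmt-Parity-21275), line `birth`, stub `stub_cyclicInverse`:
# a graph slice in one torus box has `4Γ'' − 4Γ''` a graph (GT08a arXiv Lemma 44, deduction step)

Thirteenth helper file toward the XL stub `stub_cyclicInverse` (B. Green, T. Tao, arXiv:math/0503014,
Thm. 68 = PEMS 51 (2008) Thm. 12.8).  arXiv Lemma 44: given the graph `Γ'` of Prop. 27, a set `S`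
separating the small vertical fibre `A = {ξ : (0,ξ) ∈ 8Γ' − 8Γ'}` from `0` at radius `¼`
(`A ∩ B(S,¼) = {0}`, arXiv Lemma 37) and a slice `Γ'' ⊆ Γ'` whose frequencies lie in one torus box of
side `1/64` (file `…TorusBoxes`), "if `(0, ξ)` lies in `8Γ'' − 8Γ''` then `ξ` lies in `A` and
`Ψ(ξ) ∈ 8Q − 8Q`, hence `ξ = 0` … this implies that `4Γ'' − 4Γ''` is a graph".  This def-free file
lands that deduction (Bohr conditions spelled with Mathlib's `ZMod.toAddCircle`):

* `nsmul_subset_nsmul_of_subset`, `four_sub_four_sub_eq` (`(4Γ−4Γ) − (4Γ−4Γ) = 8Γ − 8Γ`);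
* `norm_freq_nsmul_le`, `norm_freq_nsmul_sub_nsmul_le` — frequencies of `nΓ''` stay within `nδ` of
  `n•c`, those of `nΓ'' − nΓ''` within `2nδ` of `0`, when those of `Γ''` are within `δ` of `c`;
* `injOn_fst_of_vertFibre_trivial` — trivial vertical fibre of `(4Γ−4Γ) − (4Γ−4Γ)` over `0`
  ⇒ `4Γ − 4Γ` is a graph;
* `injOn_fst_four_sub_four` — **arXiv Lemma 44 (deduction)**: separation at radius `¼` + one box of
  side `δ < 1/64` ⇒ `4Γ'' − 4Γ''` is a graph.

References: [GreenTao2008U3Inverse] arXiv:math/0503014, Lemma 44 (proof), Lemma 29 (model case).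
-/

namespace Summit.Parity.GeneralizedHardyLittlewood.GreenTaoLevelTwoGITwoCyclicInverse

open Finset
open scoped Pointwise

variable {α : Type*} [AddCommGroup α] [DecidableEq α] {N : ℕ} [NeZero N]

omit [NeZero N] in
/-- Iterated sumsets are monotone: `Γ'' ⊆ Γ' ⇒ nΓ'' ⊆ nΓ'`. [folklore] -/
theorem nsmul_subset_nsmul_of_subset {Γ'' Γ' : Finset (α × ZMod N)} (h : Γ'' ⊆ Γ') (n : ℕ) :
    n • Γ'' ⊆ n • Γ' := by
  induction n with
  | zero => simp
  | succ n ih =>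
    rw [succ_nsmul, succ_nsmul]
    exact add_subset_add ih h

omit [NeZero N] in
/-- `(4Γ − 4Γ) − (4Γ − 4Γ) = 8Γ − 8Γ` for finsets in an additive commutative group. [folklore] -/
theorem four_sub_four_sub_eq (Γ : Finset (α × ZMod N)) :
    (4 • Γ - 4 • Γ) - (4 • Γ - 4 • Γ) = 8 • Γ - 8 • Γ := by
  rw [sub_sub_sub_eq, ← add_nsmul]

/-- **Frequencies of `nΓ''` stay in the dilated box**: if every `p ∈ Γ''` has
`‖toAddCircle(p.2·s) − c‖ ≤ δ` then every `x ∈ nΓ''` has `‖toAddCircle(x.2·s) − n•c‖ ≤ nδ`.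
[cite: GreenTao2008U3Inverse, Lemma 44 (proof: `Ψ(ξ) ∈ 8Q − 8Q`)] -/
theorem norm_freq_nsmul_le (Γ'' : Finset (α × ZMod N)) (s : ZMod N) (c : UnitAddCircle) {δ : ℝ}
    (hbox : ∀ p ∈ Γ'', ‖ZMod.toAddCircle (p.2 * s) - c‖ ≤ δ) (n : ℕ) :
    ∀ x ∈ n • Γ'', ‖ZMod.toAddCircle (x.2 * s) - n • c‖ ≤ n * δ := by
  induction n with
  | zero =>
    intro x hx
    rw [zero_nsmul, Finset.mem_zero] at hx
    rw [hx]
    simp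
  | succ n ih =>
    intro x hx
    rw [succ_nsmul, Finset.mem_add] at hx
    obtain ⟨y, hy, p, hp, rfl⟩ := hx
    have h1 := ih y hy
    have h2 := hbox p hp
    rw [Prod.snd_add, add_mul, map_add, succ_nsmul]
    calc ‖ZMod.toAddCircle (y.2 * s) + ZMod.toAddCircle (p.2 * s) - (n • c + c)‖
        = ‖(ZMod.toAddCircle (y.2 * s) - n • c) + (ZMod.toAddCircle (p.2 * s) - c)‖ := by
          congr 1; abel
      _ ≤ ‖ZMod.toAddCircle (y.2 * s) - n • c‖ + ‖ZMod.toAddCircle (p.2 * s) - c‖ := norm_add_le _ _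
      _ ≤ n * δ + δ := add_le_add h1 h2
      _ = (n + 1 : ℕ) * δ := by push_cast; ring

/-- Frequencies of `nΓ'' − nΓ''` are within `2nδ` of `0` (as multiples of `s`, on the circle).
[cite: GreenTao2008U3Inverse, Lemma 44 (proof)] -/
theorem norm_freq_nsmul_sub_nsmul_le (Γ'' : Finset (α × ZMod N)) (s : ZMod N) (c : UnitAddCircle)
    {δ : ℝ} (hbox : ∀ p ∈ Γ'', ‖ZMod.toAddCircle (p.2 * s) - c‖ ≤ δ) (n : ℕ) :
    ∀ z ∈ n • Γ'' - n • Γ'', ‖ZMod.toAddCircle (z.2 * s)‖ ≤ 2 * n * δ := by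
  intro z hz
  rw [Finset.mem_sub] at hz
  obtain ⟨x, hx, x', hx', rfl⟩ := hz
  have h1 := norm_freq_nsmul_le Γ'' s c hbox n x hx
  have h2 := norm_freq_nsmul_le Γ'' s c hbox n x' hx'
  rw [Prod.snd_sub, sub_mul, map_sub]
  calc ‖ZMod.toAddCircle (x.2 * s) - ZMod.toAddCircle (x'.2 * s)‖
      = ‖(ZMod.toAddCircle (x.2 * s) - n • c) - (ZMod.toAddCircle (x'.2 * s) - n • c)‖ := by
        congr 1; abel
    _ ≤ ‖ZMod.toAddCircle (x.2 * s) - n • c‖ + ‖ZMod.toAddCircle (x'.2 * s) - n • c‖ := norm_sub_le _ _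
    _ ≤ n * δ + n * δ := add_le_add h1 h2
    _ = 2 * n * δ := by ring

omit [NeZero N] in
/-- **Trivial vertical fibre ⇒ graph.** If `(0, ξ) ∈ (4Γ − 4Γ) − (4Γ − 4Γ)` forces `ξ = 0`, then the
first projection is injective on `4Γ − 4Γ`. [cite: GreenTao2008U3Inverse, Lemma 44 (proof, last step)] -/
theorem injOn_fst_of_vertFibre_trivial (Γ : Finset (α × ZMod N))
    (h : ∀ ξ : ZMod N, ((0 : α), ξ) ∈ (4 • Γ - 4 • Γ) - (4 • Γ - 4 • Γ) → ξ = 0) :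
    Set.InjOn Prod.fst ((4 • Γ - 4 • Γ : Finset (α × ZMod N)) : Set (α × ZMod N)) := by
  intro p hp q hq hpq
  rw [mem_coe] at hp hq
  have hmem : p - q ∈ (4 • Γ - 4 • Γ) - (4 • Γ - 4 • Γ) := Finset.sub_mem_sub hp hq
  have h0 : p - q = ((0 : α), p.2 - q.2) := by
    ext
    · show p.1 - q.1 = 0
      rw [hpq, sub_self]
    · rfl
  rw [h0] at hmem
  have := h _ hmem
  exact Prod.ext hpq (sub_eq_zero.mp this)

/-- **GT08a arXiv Lemma 44 (deduction step).** Let `Γ'' ⊆ Γ'`; suppose the vertical fibre of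
`8Γ' − 8Γ'` over `0` is separated from `0` at radius `¼` by `S` (every such `ξ` with
`‖ξ s/N‖_{ℝ/ℤ} < ¼` for all `s ∈ S` vanishes), and the frequencies of `Γ''` lie in one box:
`‖toAddCircle(p.2·s) − c_s‖ ≤ δ` for `p ∈ Γ''`, `s ∈ S`, with `64 δ < 1` (e.g. boxes of side `1/128`).
Then `4Γ'' − 4Γ''` is a graph. [cite: GreenTao2008U3Inverse, Lemma 44] -/
theorem injOn_fst_four_sub_four (Γ' Γ'' : Finset (α × ZMod N)) (hsub : Γ'' ⊆ Γ') (S : Finset (ZMod N))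
    (hsep : ∀ ξ : ZMod N, ((0 : α), ξ) ∈ 8 • Γ' - 8 • Γ' →
      (∀ s ∈ S, ‖ZMod.toAddCircle (ξ * s)‖ < 1 / 4) → ξ = 0)
    (c : ZMod N → UnitAddCircle) {δ : ℝ} (hδ : 64 * δ < 1)
    (hbox : ∀ p ∈ Γ'', ∀ s ∈ S, ‖ZMod.toAddCircle (p.2 * s) - c s‖ ≤ δ) :
    Set.InjOn Prod.fst ((4 • Γ'' - 4 • Γ'' : Finset (α × ZMod N)) : Set (α × ZMod N)) := by
  refine injOn_fst_of_vertFibre_trivial Γ'' fun ξ hξ => ?_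
  rw [four_sub_four_sub_eq] at hξ
  have hξ' : ((0 : α), ξ) ∈ 8 • Γ' - 8 • Γ' :=
    sub_subset_sub (nsmul_subset_nsmul_of_subset hsub 8) (nsmul_subset_nsmul_of_subset hsub 8) hξ
  refine hsep ξ hξ' fun s hs => ?_
  have h := norm_freq_nsmul_sub_nsmul_le Γ'' s (c s) (fun p hp => hbox p hp s hs) 8 _ hξ
  have h' : ‖ZMod.toAddCircle (ξ * s)‖ ≤ 2 * 8 * δ := h
  calc ‖ZMod.toAddCircle (ξ * s)‖ ≤ 2 * 8 * δ := h'
    _ < 1 / 4 := by linarith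

end Summit.Parity.GeneralizedHardyLittlewood.GreenTaoLevelTwoGITwoCyclicInverse
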